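import Literature.Topology.FourManifolds.ComplexProjectiveSpaceCohomology
import Literature.Topology.FourManifolds.ComplexProjectiveSpaceHomologyProofs
import Literature.Topology.FourManifolds.HomotopySpheresStablyParallelizableHomotopyGroup
import Literature.AlgebraicTopology.Homotopy.SphereMapsHomotopyGroups
import HarnessLib

/-!
# Extending maps from `ℂℙⁿ` over the top cell of `ℂℙⁿ⁺¹`

Topic `Literature/Topology/FourManifolds` (home of the tree's `ComplexProjectiveSpace n`).
A. Hatcher, *Algebraic Topology* (2002), Example 0.6 (p. 6: "`ℂPⁿ` is obtained from `ℂPⁿ⁻¹` by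
attaching a cell `e²ⁿ`") together with the extension criterion of §4.1, p. 346 ("a map `Sⁿ → X`
extends to a map `Dⁿ⁺¹ → X` iff it is nullhomotopic", and every map `Sⁿ → X` is nullhomotopic
when `πₙ(X) = 0`, Lemma 4.7 / Prop. 4.13-type cell-by-cell extension: "the composition
`Sⁿ → X → Y` … is nullhomotopic since `πₙ(Y) = 0`, so the map extends over the cell"). In the
tree's embedded form of Example 0.6 (`ComplexProjectiveSpace.exists_isAttachedCell`: the inverse
affine chart on the closed unit ball `D²ⁿ⁺²` is a closed cell attached to the complement `Y'` of
the open chart ball, `Y' ∪ D = ℂℙⁿ⁺¹`; `isStrongDeformationRetractOf_setOf_not_coordNeZero`: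
`Y'` strongly deformation retracts onto the hyperplane `{vᵢ = 0} = hyperplaneEmb i (ℂℙⁿ)`), we
PROVE (no definitions besides the iterated hyperplane, no named facts):

* `ComplexProjectiveSpace.exists_extension_hyperplaneEmb` — **if `T` is path connected with
  `π₂ₙ₊₁(T, t) = 0` for all `t`, every map `g : ℂℙⁿ → T` extends over `ℂℙⁿ⁺¹`**: there is
  `G : ℂℙⁿ⁺¹ → T` with `G ∘ hyperplaneEmb i = g` (retract `Y'` onto the hyperplane and follow with
  `g`; on the boundary sphere `S²ⁿ⁺¹` of the cell this is nullhomotopic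
  (`homotopic_const_of_sphere_of_subsingleton_homotopyGroup`), hence extends over the ball
  (`exists_sphere_extends_of_nullhomotopic`); the two pieces are glued along the closed cover
  `Y' ∪ D`);
* `ComplexProjectiveSpace.iterHyperplaneEmb m k : C(ℂℙᵐ, ℂℙᵐ⁺ᵏ)` — the standard linear embedding
  `[w] ↦ [w : 0 : ⋯ : 0]` (`k` zeros appended), and
  **`ComplexProjectiveSpace.exists_extension_iterHyperplaneEmb`** — if `π₂ⱼ₊₁(T) = 0` for all
  `j ≥ m` then every `g : ℂℙᵐ → T` extends to `ℂℙᵐ⁺ᵏ → T` along `iterHyperplaneEmb m k`, for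
  every `k` (induction).

This is the obstruction-free half of obstruction theory for the even-cell complex `ℂPᴺ`
(cells in dimensions `0, 2, …, 2N` only): it produces the comparison maps `ℂPᴺ → K` into any
space `K` with vanishing odd homotopy groups (e.g. a `K(ℤ, 2)`), the route to the cohomology ring
of `K(ℤ, 2)` in a range of degrees.

## References

* A. Hatcher, *Algebraic Topology*, CUP (2002), Example 0.6 (p. 6); §4.1 p. 346 (extension
  criterion), Lemma 4.7, proof of Prop. 4.13 (p. 353, cell-by-cell extension). [HatcherAT2002]
-/

noncomputable section

open Set Metric Function Topology
open scoped unitInterval Topology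

namespace Literature.Topology.FourManifolds

open Literature.AlgebraicTopology.SingularHomology Literature.AlgebraicTopology.Homotopy

namespace ComplexProjectiveSpace

variable {n : ℕ}

/-! ### One cell -/

/-- **Extension over the top cell of `ℂℙⁿ⁺¹`** (Hatcher 2002, Example 0.6 with §4.1 p. 346):
if `T` is path connected and `π₂ₙ₊₁(T, t)` is trivial for every `t`, then every continuous
`g : ℂℙⁿ → T` extends along the hyperplane embedding `hyperplaneEmb i : ℂℙⁿ ↪ ℂℙⁿ⁺¹` to a
continuous `G : ℂℙⁿ⁺¹ → T`, `G ∘ hyperplaneEmb i = g`. Proof: `ℂℙⁿ⁺¹ = Y' ∪ D` with `D = D²ⁿ⁺²`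
the closed chart ball (an embedded closed cell) and `Y'` the complement of the open chart ball,
which strongly deformation retracts onto the hyperplane by a retraction `ρ`; put `G = g ∘ ρ` on
`Y'`; on `∂D = S²ⁿ⁺¹` this is nullhomotopic since `π₂ₙ₊₁(T) = 0`, so it extends over `D`; glue
along the closed cover. [cite: HatcherAT2002, Example 0.6 and §4.1 p. 346] -/
theorem exists_extension_hyperplaneEmb {T : Type*} [TopologicalSpace T] [PathConnectedSpace T]
    (hT : ∀ t : T, Subsingleton (π_ (2 * n + 1) T t)) (i : Fin (n + 2))
    (g : C(ComplexProjectiveSpace n, T)) :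
    ∃ G : C(ComplexProjectiveSpace (n + 1), T), ∀ p, G (hyperplaneEmb i p) = g p := by
  classical
  -- the pieces of `ℂℙⁿ⁺¹`
  set Y' : Set (ComplexProjectiveSpace (n + 1)) :=
    {p | CoordNeZero i p ∧ ‖affineChart i p‖ < 1}ᶜ with hY'
  set A : Set (ComplexProjectiveSpace (n + 1)) := {p | ¬ CoordNeZero i p} with hAdef
  obtain ⟨Φ, hΦ, hcov, -⟩ := exists_isAttachedCell (n := n) i
  obtain ⟨H, -, hH1, hHfix⟩ := isStrongDeformationRetractOf_setOf_not_coordNeZero (n := n) i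
  have hA : A = range (hyperplaneEmb (n := n) i) := (range_hyperplaneEmb i).symm
  -- `e : ℂℙⁿ ≃ₜ` hyperplane
  let e : ComplexProjectiveSpace n ≃ₜ ↥(range (hyperplaneEmb (n := n) i)) :=
    (isClosedEmbedding_hyperplaneEmb (n := n) i).isEmbedding.toHomeomorph
  have he : ∀ p, (e p : ComplexProjectiveSpace (n + 1)) = hyperplaneEmb i p := fun p =>
    (isClosedEmbedding_hyperplaneEmb (n := n) i).isEmbedding.toHomeomorph_apply_coe p
  have hH1' : ∀ x : ↥Y', (H (1, x) : ComplexProjectiveSpace (n + 1)) ∈ range (hyperplaneEmb (n := n) i) :=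
    fun x => hA ▸ hH1 x
  -- the retraction `ρ : Y' → ℂℙⁿ` and `g₁ = g ∘ ρ`
  let ρ : ↥Y' → ComplexProjectiveSpace n := fun x => e.symm ⟨_, hH1' x⟩
  have hρ : Continuous ρ :=
    e.symm.continuous.comp ((continuous_subtype_val.comp
      (H.continuous.comp (Continuous.prodMk_right (1 : I)))).subtype_mk _)
  let g₁ : C(↥Y', T) := ⟨fun x => g (ρ x), g.continuous.comp hρ⟩
  have hmemA : ∀ p, hyperplaneEmb i p ∈ A := fun p => by rw [hA]; exact mem_range_self p
  have hmemY' : ∀ p, hyperplaneEmb i p ∈ Y' := fun p => setOf_not_coordNeZero_subset i (hmemA p)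
  have hg₁ : ∀ p, g₁ ⟨hyperplaneEmb i p, hmemY' p⟩ = g p := fun p => by
    change g (e.symm ⟨_, hH1' ⟨hyperplaneEmb i p, hmemY' p⟩⟩) = g p
    congr 1
    apply e.injective
    rw [e.apply_symm_apply]
    apply Subtype.ext
    rw [he]
    exact congrArg Subtype.val (hHfix 1 ⟨hyperplaneEmb i p, hmemY' p⟩ (hmemA p))
  -- the boundary sphere of the cell
  let E := EuclideanSpace ℝ (Fin (2 * (n + 1)))
  have hE : Module.finrank ℝ E = (2 * n + 1) + 1 := by
    rw [finrank_euclideanSpace_fin]; ring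
  have hball : ∀ u : sphere (0 : E) 1, (u : E) ∈ closedBall (0 : E) 1 :=
    fun u => sphere_subset_closedBall u.2
  have hsph : ∀ u : sphere (0 : E) 1, Φ ⟨u, hball u⟩ ∈ Y' := fun u =>
    (hΦ.mem_iff _).2 (by simp)
  let ψ : C(sphere (0 : E) 1, T) :=
    ⟨fun u => g₁ ⟨Φ ⟨u, hball u⟩, hsph u⟩,
      g₁.continuous.comp ((Φ.continuous.comp (continuous_subtype_val.subtype_mk _)).subtype_mk _)⟩
  obtain ⟨t₀⟩ : Nonempty T := PathConnectedSpace.nonempty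
  have hnull : ψ.Nullhomotopic :=
    ⟨t₀, homotopic_const_of_sphere_of_subsingleton_homotopyGroup hE (fun _ => hT) ψ t₀⟩
  obtain ⟨F, hF⟩ := exists_sphere_extends_of_nullhomotopic ψ hnull
  -- glue
  have hcov' : ∀ x, x ∉ range Φ → x ∈ Y' := fun x hx =>
    ((hcov.symm ▸ mem_univ x : x ∈ Y' ∪ range Φ)).resolve_right hx
  let G : ComplexProjectiveSpace (n + 1) → T := fun x =>
    if hx : x ∈ range Φ then F ((hΦ.discHomeomorph.symm ⟨x, hx⟩ : closedBall (0 : E) 1) : E)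
    else g₁ ⟨x, hcov' x hx⟩
  -- on `Y'` the glued map is `g₁`
  have hGY' : ∀ (x) (hx : x ∈ Y'), G x = g₁ ⟨x, hx⟩ := by
    intro x hx
    by_cases hxΦ : x ∈ range Φ
    · have hGx : G x = F ((hΦ.discHomeomorph.symm ⟨x, hxΦ⟩ : closedBall (0 : E) 1) : E) :=
        dif_pos hxΦ
      set w := hΦ.discHomeomorph.symm ⟨x, hxΦ⟩ with hw
      have hΦw : Φ w = x := hΦ.apply_discHomeomorph_symm ⟨x, hxΦ⟩
      have hw1 : ‖(w : E)‖ = 1 := (hΦ.mem_iff w).1 (hΦw.symm ▸ hx)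
      have hws : (w : E) ∈ sphere (0 : E) 1 := mem_sphere_zero_iff_norm.2 hw1
      rw [hGx, hF ⟨(w : E), hws⟩]
      change g₁ ⟨Φ ⟨(w : E), hball ⟨(w : E), hws⟩⟩, _⟩ = g₁ ⟨x, hx⟩
      congr 1
      apply Subtype.ext
      change Φ ⟨(w : E), hball ⟨(w : E), hws⟩⟩ = x
      rw [← hΦw]
    · exact dif_neg hxΦ
  have hG : Continuous G := by
    rw [← continuousOn_univ, ← hcov]
    refine ContinuousOn.union_of_isClosed ?_ ?_ hΦ.isClosed hΦ.isClosed_range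
    · rw [continuousOn_iff_continuous_restrict]
      have hrw : Y'.restrict G = g₁ := funext fun x => hGY' x x.2
      rw [hrw]
      exact g₁.continuous
    · rw [continuousOn_iff_continuous_restrict]
      have hrw : (range Φ).restrict G =
          fun z => F ((hΦ.discHomeomorph.symm z : closedBall (0 : E) 1) : E) :=
        funext fun z => dif_pos z.2
      rw [hrw]
      exact F.continuous.comp (continuous_subtype_val.comp hΦ.discHomeomorph.symm.continuous)
  refine ⟨⟨G, hG⟩, fun p => ?_⟩
  change G (hyperplaneEmb i p) = g p
  rw [hGY' _ (hmemY' p), hg₁]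

/-! ### Iterating: `ℂℙᵐ ↪ ℂℙᵐ⁺ᵏ` -/

/-- **The standard embedding `ℂℙᵐ ↪ ℂℙᵐ⁺ᵏ`, `[w] ↦ [w : 0 : ⋯ : 0]`** (`k` zeros appended; the
`k`-fold iterate of the hyperplane embedding at the last slot). [cite: HatcherAT2002, Example 0.6] -/
def iterHyperplaneEmb (m : ℕ) : (k : ℕ) → C(ComplexProjectiveSpace m, ComplexProjectiveSpace (m + k))
  | 0 => ContinuousMap.id _
  | k + 1 => (⟨hyperplaneEmb (Fin.last (m + k + 1)), continuous_hyperplaneEmb _⟩ :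
      C(ComplexProjectiveSpace (m + k), ComplexProjectiveSpace (m + k + 1))).comp (iterHyperplaneEmb m k)

/-- `iterHyperplaneEmb m 0 = 𝟙`. [folklore] -/
@[simp] theorem iterHyperplaneEmb_zero (m : ℕ) (p : ComplexProjectiveSpace m) :
    iterHyperplaneEmb m 0 p = p := rfl

/-- `iterHyperplaneEmb m (k + 1) = hyperplaneEmb last ∘ iterHyperplaneEmb m k`. [folklore] -/
theorem iterHyperplaneEmb_succ (m k : ℕ) (p : ComplexProjectiveSpace m) :
    iterHyperplaneEmb m (k + 1) p = hyperplaneEmb (Fin.last (m + k + 1)) (iterHyperplaneEmb m k p) := rfl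

/-- `iterHyperplaneEmb` is one-to-one. [folklore] -/
theorem iterHyperplaneEmb_injective (m : ℕ) : ∀ k, Injective (iterHyperplaneEmb m k)
  | 0 => fun _ _ h => h
  | k + 1 => (hyperplaneEmb_injective _).comp (iterHyperplaneEmb_injective m k)

/-- **Extension along `ℂℙᵐ ↪ ℂℙᵐ⁺ᵏ`** (Hatcher 2002, Example 0.6 with §4.1 p. 346, iterated cell
by cell as in the proof of Prop. 4.13): if `T` is path connected with `π₂ⱼ₊₁(T, t) = 0` for all
`j ≥ m` and all `t`, then every `g : ℂℙᵐ → T` extends to `G : ℂℙᵐ⁺ᵏ → T` with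
`G ∘ iterHyperplaneEmb m k = g`. [cite: HatcherAT2002, Example 0.6 and §4.1 p. 346] -/
theorem exists_extension_iterHyperplaneEmb {T : Type*} [TopologicalSpace T] [PathConnectedSpace T]
    {m : ℕ} (hT : ∀ j, m ≤ j → ∀ t : T, Subsingleton (π_ (2 * j + 1) T t)) :
    ∀ (k : ℕ) (g : C(ComplexProjectiveSpace m, T)),
      ∃ G : C(ComplexProjectiveSpace (m + k), T), ∀ p, G (iterHyperplaneEmb m k p) = g p
  | 0, g => ⟨g, fun _ => rfl⟩
  | k + 1, g => by
    obtain ⟨G, hG⟩ := exists_extension_iterHyperplaneEmb hT k g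
    obtain ⟨G', hG'⟩ := exists_extension_hyperplaneEmb (n := m + k) (hT (m + k) (Nat.le_add_right m k))
      (Fin.last (m + k + 1)) G
    exact ⟨G', fun p => by rw [iterHyperplaneEmb_succ, hG', hG]⟩

end ComplexProjectiveSpace

end Literature.Topology.FourManifolds

end
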